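import Summits.HodgeConjecture.HodgeConjecture.Cruxes.BlochSeedDiscOne.SeedChecker

/-!
# `Cruxes/BlochSeedDiscOne/SeedCheckerOneAnchor.lean` — SEED CHECKER v11 (§14): ONE ANCHOR SUFFICES; the monad road of the
# lci door; the json-PREDICTED `h⁴`-coefficient of the seed class and its twist quartic; the checker is twist-blind; «every
# section vanishes somewhere»; redundancies inside the checker

`line stmt-HodgeConjecture-18881 Cruxes/BlochSeedDiscOne/Lines/birth.lean 814a6a70c14e831a stub_rung_pad4_seedAt` · explicit unit
`hsemireg-c5c8-1` (g10; director MINT A5: C5–C8 typed as predicates on (design json, presentation)) · **a SATELLITE IN THE v4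
NAMESPACE** `Summit.HodgeConjecture.HodgeConjecture.Cruxes.BlochSeedDiscOne.SeedChecker` — it imports ONLY `SeedChecker.lean` v4
(`13437bb9848c3c36`, the built member of the family); it does NOT import the satellites v5 `SeedCheckerPorteous`, v6.2 `SeedCheckerKit`,
v7.1 `SeedCheckerFrame`, v8 `SeedCheckerBalanced`, v9 `SeedCheckerDescent`, v10 `SeedCheckerWords` (farm snapshot stale: `lean check`
rc 75 `unbuilt` at 2026-08-30T01:25Z) and redeclares none of their names.

## Honest framing (mandatory)

NOTHING in this file is proved toward HC ∕ HC_CM ∕ HC_AV ∕ №4 ∕ 26512 ∕ 18881 ∕ H2. It contains no `sorry`, constructs no bundle,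
section, zero scheme or seed, and touches no stub: `stub_rung_pad4_seedAt` is neither weakened nor specialised — its binders are only
COMPARED with the crux's. The seat produces evidence and typed files, not rungs. Every theorem below is hypothesis-carrying door algebra
(`exact?`-safe: each needs a certificate ∕ a law ∕ a realisation as input).

## What v11 adds (all additive; no declaration of v4 is changed)

§14.1 **ONE ANCHOR SUFFICES (C7-compat flag, made a theorem).** The crux `BlochSeedDiscOne := HasHyperbolicBlochSeed 4 1` is
EXISTENTIAL in the eightfold (`∃ P ψ₀ e a w, …`). Hence a `SeedCertificate E₀ ψ₀`, a passing `Design.SeedCheck K i q`, or zero-scheme ∕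
twisted-presentation data on ONE CM anchor `(E₀, ψ₀)`, `E₀.dim = 1`, `ψ₀ ≫ ψ₀ = -1`, closes the crux BY NAME:
`blochSeedDiscOne_of_seedData_one ∕ _of_certificate_one ∕ _of_seedCheck_one ∕ _of_zeroScheme_one ∕
_of_twistedKernelPresentation_one ∕ _of_twistedCokernelPresentation_one ∕ _of_twistedMonadPresentation_one`. All v4 ∕ v6.2 lci doors
(`blochSeedDiscOne_of_certificates ∕ _seedChecks ∕ _zeroSchemes`, Kit `…_seedChecks' ∕ _lciSeeds`) demand the data on EVERY CM anchor,
because they factor through `Anchor.blochSeedDiscOne_of_forall_pad4_seedAt`, i.e. through the STUB's universally quantified binders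
`(E₀ ψ₀ hE hψ)`. FLAG (C7 pad4-tower compatibility): the `∀ (E₀, ψ₀)`-uniformity is a requirement of `stub_rung_pad4_seedAt`'s SIGNATURE
only (to close the stub by name one must serve every CM anchor — all isomorphic to `(ℂ∕ℤ[i], ±i)`, but no transport lemma along such an
isomorphism is in the tree), NOT of the crux; the sheaf door (`hasHyperbolicBFSheafSeedOn_of_sheafSeedCheck`, v4 §4) was already
one-anchor. `blochSeedDiscOne_of_certificates_via_one` re-derives v4's `∀`-door from the one-anchor door and `exists_cmCurve_sqrt_neg 1`.

§14.2 **THE MONAD ROAD, both doors.** v4 §7.3 typed the twisted KERNEL and COKERNEL routes of the lci door; the designs of record that are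
monads (`S84Monad`, `S131Monad`: `𝓐 ↪ 𝓑 ↠ 𝓒`, `𝓔 = ker b ∕ im a`, v3 `MonadPresentation`) get `Design.seedCheck_of_twistedMonadPresentation`
(lci door, GIVEN the law `TopChernFourLocalisation C`) and, for the sheaf door, the two one-liners v3 announced but did not write,
`hasHyperbolicBFSheafSeedOn_of_cokernelPresentation ∕ _of_monadPresentation`.

§14.3 **THE SEED CLASS'S `h⁴`-COEFFICIENT IS A JSON NUMBER.** `Design.chCoeff D p = c_p(D)∕p!` and
`Design.chernFourCoeff D = c₁⁴∕24 − c₁²c₂∕2 + c₂²∕2 + 2c₁c₃ − 6c₄` (Newton, Fulton Ex. 3.2.3, in the `ℚ[h]`-coordinates of the design);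
`Design.chernFour_eq_of_realisedBy`: a sheaf REALISING `D` through the frame `(h, r₁, r₂)` has
**`c₄ = chernFourCoeff(D) · h⁴ + wOf(−6 μ(D))`** — v4's `chernFour_eq_of_cleanAtSeed` with the `∃ q'` replaced by the json number. For a
twist, `chernFourCoeff (D.tw t)` is an explicit quartic in `t` through v4's `Design.tw_coeff`. Consequences typed: (σ)'s rational number is
PREDICTED — `supported_explicit_of_zeroScheme` (`(−chernFourCoeff∕6)·h⁴ + wOf μ` supported on `Z(s)`, GIVEN the law) and
`Design.seedCheck_of_zeroScheme_explicit` (`D.SeedCheck K i q` with `q = −chernFourCoeff(D')∕(6·(2t_pol)⁴)`, `D'` the realised twisted design,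
`t_pol` the kit's polarisation scale); and the json screen `Design.degreeSignAt D t := 0 < chernFourCoeff (D.tw t)` (a `Bool`; PENCIL, not
Lean: with `h` ample and `W ⟂ h⁴` in the top-degree pairing — `e·u = e·v = 0` in `H⁴(S)` since `H³(E₀) = 0` — `deg_h Z(s) = chernFourCoeff(D(t)) ·
deg h⁸`, so a non-empty zero scheme of pure codimension `4` needs `degreeSignAt D t = true`). Not asserted as a theorem about seeds: the
degree functional is not in v4.
§14.3b **THE TWIST QUARTIC** `Design.chernFourCoeff_tw` (clean `D`, rank `r = c₀`): `c₄(D(t)) = c₄ + (r−3)c₃t + C(r−2,2)c₂t² + C(r−1,3)c₁t³ +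
C(r,4)t⁴` — the `h⁴`-coefficient of `c(E ⊗ L) = Σ_k c_k(E)(1+th)^{r−k}`, DERIVED (by `ring`) from `ch(𝓔(tH)) = ch(𝓔)e^{tH}` (v4 `tw_coeff`,
closed forms `tw_coeff_one … _four`) and Newton (`chernOne∕Two∕ThreeCoeff`). FLAGS: rank `3` (v5's degeneracy door, `[𝓝] − [𝓟]`):
`chernFourCoeff_tw_of_rank_three` — the number, hence the degree sign, is TWIST-INVARIANT (one json bit per design); rank `4`:
`chernFourCoeff_tw_of_rank_four` — a MONIC quartic, so `degreeSignAt_of_rank_four`: the screen passes for every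
`t ≥ 1 + |c₄| + |c₃| + |c₂| + |c₁|` (`quartic_pos_of_le`) and constrains only the presentation's ACTUAL twist.
§14.3d `c4OfCoeffs` (the json evaluator, `Design.chernFourCoeff_eq_c4OfCoeffs`) and `c4OfCoeffs_records`: the six designs of record
(kernel-certified `q`-tables of `DesignCert*`, hsemireg-check-kernel-1) all have `c₄ > 0` (`norm_num`).
§14.3c **THE lci CHECKER IS TWIST-BLIND ON THE JSON SIDE**: `Design.tw_neg_tw` (`D(t)(−t) = D`), `tw_clean_iff`, `tw_classData_iff`,
`tw_seedCheck_iff : (D.tw t).SeedCheck K i q ↔ D.SeedCheck K i q`, `tw_classDataRankFree_iff` — C5's «twist» is pure presentation data.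

§14.4 **EVERY SECTION VANISHES SOMEWHERE (the class shadow of Fulton–Lazarsfeld), GIVEN the law.** `chernFour_eq_zero_of_isEmpty`: a
section whose zero scheme is EMPTY kills `c₄` (`TopChernFourLocalisation` + the tree's `classesSupportedOn_empty`); hence, if the frame
SEPARATES `h⁴` from `W` (`WeilFrame.SeparatesH4 F h : s·h⁴ + wOf ν = 0 → ν = 0` — a HYPOTHESIS here; it is v8's
`WeilFrame.mu_eq_of_eq` for balanced `h`, i.e. dischargeable for `h_std ∕ h_K` once v8 is built jointly), a rank-`4` bundle realising a
design with `μ ≠ 0` has NO nowhere-vanishing section (`nonempty_zeroScheme_of_realisedBy`), and more generally a class passing (σ)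
cannot be supported on an empty seed (`nonempty_of_supported`). FLAG: for the CHECKER this is already implied by C6 — `IsIntegral Z`
carries `Nonempty Z` (`SeedCertificate.seed_nonempty`); the content of §14.4 is the converse direction «(σ) alone forbids `Z = ∅`».

§14.0 **THE CODIMENSION LAW OF REGULAR IMMERSIONS IS A THEOREM** (`codimOfRegularImmersion : CodimOfRegularImmersion`, every scheme,
no Noetherian hypothesis; kernel-closed, axioms `propext ∕ Classical.choice ∕ Quot.sound`): the points of a closed lci subscheme of
codimension `n` have `Order.coheight ≥ n` (the tree orders scheme points by `x ≤ y ↔ y ⤳ x`, so `coheight z = dim 𝒪_{X,z}`, Mathlib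
`ringKrullDim_stalk_eq_coheight`). Ingredients, all Mathlib: the `n` weakly regular generators localise to a REGULAR sequence in `𝔪_{X,z}`
(`IsAffineOpen.isLocalization_stalk`, `IsWeaklyRegular.isRegular_of_isLocalization_of_mem`; membership in `𝔪` because the stalk map to the
non-trivial local ring `𝒪_{Z,z}` kills kernel sections, `germ_mem_maximalIdeal_of_mem_ker`), and **a regular sequence on a finite module has
length `≤ dim Supp`** (`length_le_supportDim_of_isRegular`, induction via `Module.supportDim_quotSMulTop_succ_le_of_notMem_minimalPrimes` +
`IsSMulRegular.notMem_of_mem_minimalPrimes` — Mathlib has the EQUALITY only for Noetherian local rings; the inequality needs neither).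

§14.5 **REDUNDANCIES INSIDE THE CHECKER (theorems).** `Design.seedCheck_iff_minimal` ∕ `hasBlochSeedAt_iff_four`: TWO clauses of
`HasBlochSeedAt` ∕ `Design.SeedCheck` are implied by C5 — the standalone `IsClosedImmersion i` (`IsRegularImmersionOfCodim.isClosedImmersion`)
AND C6's «closed points of codimension `≥ 4`» (§14.0). The lci checker has FIVE clauses: C0 json, lci of codimension `4`, integral,
Bloch-semiregular, (σ); the crux's `HasBlochSeedAt n P h w` has FOUR (`hasBlochSeedAt_of_four`). Every door of this file is stated WITHOUT
the `hcoh` binder that v4's doors carry (it is derived: `codimOfRegularImmersion i 4 hreg`).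

## C5–C8 flag table, cumulative delta (g10)
* C5 (σ ∕ lci ∕ twist): object half's `q` is json-predicted (§14.3); the twist `t` is invisible to `Design.SeedCheck` (§14.3c) and enters
  only `q` and the degree sign quartic (§14.3b; rank-`3`: twist-invariant; rank-`4`: passes for `t ≫ 0`; designs of record: `c₄ > 0`);
  `IsClosedImmersion` clause redundant given the lci clause (§14.5). Design half unchanged (`μ ≠ 0`).
* C6 (A1@Z ∕ integral ∕ codim): seed non-emptiness is implied by integrality (§14.4); **the codimension clause is IMPLIED BY C5 — THEOREM**
  (§14.0 `codimOfRegularImmersion`, §14.5): as a checker clause it is REDUNDANT (not vacuous: it is true of every lci seed, false data cannot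
  reach it); the monad presentation now feeds both doors (§14.2).
* C7 (pad4-compat): `∀`-anchor uniformity = STUB-ONLY; the crux needs ONE anchor (§14.1, theorems). Not vacuous for the stub, vacuous for
  the crux.
* C8 (disc-one): unchanged — `d = 1` is in the types (`HasHyperbolicBlochSeed 4 1`, v4 `symH_discOne`); vacuous per design.

References: [cite: Fulton1998, Example 3.2.2, Example 3.2.3, Example 14.1.1, Prop. 14.1 (b)]; [cite: GortzWedhorn2023, Def. 19.19 and Def. 19.23]; [cite: FultonLazarsfeld1981] (connectivity and
non-emptiness of zero loci of ample bundles — only its CLASS shadow is typed here); v4 `SeedChecker.lean` §4, §7.1, §7.3.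
-/

noncomputable section

set_option linter.dupNamespace false

open CategoryTheory AlgebraicGeometry
open Literature.AlgebraicGeometry Literature.AlgebraicGeometry.Motives Literature.AlgebraicGeometry.HodgeTheory
open Literature.AlgebraicTopology.SingularHomology

namespace Summit.HodgeConjecture.HodgeConjecture.Cruxes.BlochSeedDiscOne.SeedChecker

open Summit.HodgeConjecture.HodgeConjecture.Cruxes.BlochSeedDiscOne.Anchor
open Summit.Ventures.HSemireg Summit.Ventures.HSemireg.Pad4Tower

/-! ## §14.0 The codimension law of regular immersions is a THEOREM (C6's codimension clause is implied by C5) -/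

section CodimLaw

open RingTheory.Sequence

/-- **THE CODIMENSION LAW OF REGULAR IMMERSIONS** — «a point of a closed lci subscheme of codimension `n` has codimension `≥ n` in the
ambient scheme» (`Order.coheight` for the tree's order on scheme points, `x ≤ y ↔ y ⤳ x`, so `coheight z = dim 𝒪_{X,z}`,
Mathlib `ringKrullDim_stalk_eq_coheight`). PROVED below (`codimOfRegularImmersion`) for EVERY scheme, no Noetherian hypothesis: the `n`
generators of the ideal become a REGULAR sequence in `𝔪_{X,z}` and a regular sequence has length `≤` the dimension. Kept as a named `Prop`
because v11.0 stated the doors modulo it. [cite: GortzWedhorn2023, Def. 19.19 and Def. 19.23] -/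
def CodimOfRegularImmersion : Prop :=
  ∀ ⦃X Z : Scheme.{0}⦄ (i : Z ⟶ X) (n : ℕ), IsRegularImmersionOfCodim i n →
    ∀ z ∈ Set.range i.base, (n : ℕ∞) ≤ Order.coheight z

/-- **a regular sequence on a finite module has length `≤` the dimension of its support** (no Noetherian hypothesis): induction on
the sequence with Mathlib's `Module.supportDim_quotSMulTop_succ_le_of_notMem_minimalPrimes` (an `M`-regular element lies in no minimal
prime of `Supp M`, `IsSMulRegular.notMem_of_mem_minimalPrimes`) and `isWeaklyRegular_cons_iff`. -/
theorem length_le_supportDim_of_isRegular {R : Type*} [CommRing R] {M : Type*} [AddCommGroup M] [Module R M]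
    [Module.Finite R M] (rs : List R) (reg : IsRegular M rs) : (rs.length : WithBot ℕ∞) ≤ Module.supportDim R M := by
  induction rs generalizing M with
  | nil =>
    have hnt : Nontrivial M := by
      have h := reg.top_ne_smul
      rw [Ideal.ofList_nil, Submodule.bot_smul] at h
      exact (Submodule.nontrivial_iff R).mp (nontrivial_of_ne _ _ h)
    have hb := (Module.supportDim_ne_bot_iff_nontrivial R M).mpr hnt
    obtain ⟨d, hd⟩ := WithBot.ne_bot_iff_exists.mp hb
    rw [← hd, List.length_nil, Nat.cast_zero]
    calc (0 : WithBot ℕ∞) = ((0 : ℕ∞) : WithBot ℕ∞) := WithBot.coe_zero.symm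
      _ ≤ (d : WithBot ℕ∞) := WithBot.coe_le_coe.mpr bot_le
  | cons x rs ih =>
    have h1 := (isWeaklyRegular_cons_iff M x rs).mp reg.toIsWeaklyRegular
    have hnt : Nontrivial (M ⧸ (Ideal.ofList (x :: rs) • ⊤ : Submodule R M)) :=
      Submodule.Quotient.nontrivial_iff.mpr reg.top_ne_smul.symm
    have hnt' : Nontrivial (QuotSMulTop x M ⧸ (Ideal.ofList rs • ⊤ : Submodule R (QuotSMulTop x M))) :=
      (Submodule.quotOfListConsSMulTopEquivQuotSMulTopInner M x rs).toEquiv.symm.nontrivial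
    have reg' : IsRegular (QuotSMulTop x M) rs :=
      ⟨h1.2, (Submodule.Quotient.nontrivial_iff.mp hnt').symm⟩
    have ih' := ih reg'
    have step := Module.supportDim_quotSMulTop_succ_le_of_notMem_minimalPrimes (M := M) (x := x)
      (fun p hp => h1.1.notMem_of_mem_minimalPrimes hp)
    calc ((x :: rs).length : WithBot ℕ∞) = (rs.length : WithBot ℕ∞) + 1 := by
          rw [List.length_cons, Nat.cast_succ]
      _ ≤ Module.supportDim R (QuotSMulTop x M) + 1 := add_le_add ih' le_rfl
      _ ≤ Module.supportDim R M := step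

/-- **a regular sequence in a commutative ring has length `≤` the Krull dimension.** -/
theorem length_le_ringKrullDim_of_isRegular {R : Type*} [CommRing R] (rs : List R) (reg : IsRegular R rs) :
    (rs.length : WithBot ℕ∞) ≤ ringKrullDim R := by
  rw [← Module.supportDim_self_eq_ringKrullDim]
  exact length_le_supportDim_of_isRegular rs reg

/-- the germ of a section of the kernel ideal of `i : Z ⟶ X` at a point of the image is a NON-UNIT (the stalk map is a ring map to the
non-trivial local ring `𝒪_{Z,z}` killing it). -/
theorem germ_mem_maximalIdeal_of_mem_ker {X Z : Scheme.{0}} (i : Z ⟶ X) (U : X.affineOpens) (z : Z)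
    (hx : i.base z ∈ (U : X.Opens)) {r : Γ(X, U)} (hr : r ∈ i.ker.ideal U) :
    X.presheaf.germ U (i.base z) hx r ∈ IsLocalRing.maximalIdeal (X.presheaf.stalk (i.base z)) := by
  rw [IsLocalRing.mem_maximalIdeal, mem_nonunits_iff]
  intro hu
  have h0 : (i.app U).hom r = 0 := i.ideal_ker_le U hr
  have h1 := hu.map (i.stalkMap z).hom
  have h2 : (i.stalkMap z).hom (X.presheaf.germ U (i.base z) hx r) = 0 := by
    have := Scheme.Hom.germ_stalkMap_apply i U z hx r
    rw [show (i.app U) r = 0 from h0, map_zero] at this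
    exact this
  rw [h2, isUnit_zero_iff] at h1
  exact zero_ne_one h1

/-- **THE CODIMENSION LAW IS A THEOREM** (every scheme): localise the `n` weakly regular generators of the ideal at the point
(`IsAffineOpen.isLocalization_stalk`; they land in `𝔪_{X,x}` by `germ_mem_maximalIdeal_of_mem_ker`, hence form a REGULAR sequence by
`IsWeaklyRegular.isRegular_of_isLocalization_of_mem`), bound the length by the dimension (`length_le_ringKrullDim_of_isRegular`), and read
`dim 𝒪_{X,x} = coheight x` (`ringKrullDim_stalk_eq_coheight`). Consequence: C6's codimension clause of `HasBlochSeedAt` ∕ `Design.SeedCheck`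
IS IMPLIED BY C5 (§14.5 `Design.seedCheck_iff_minimal`, `hasBlochSeedAt_iff_four`), and every door below drops its `hcoh` binder. -/
theorem codimOfRegularImmersion : CodimOfRegularImmersion := by
  intro X Z i n h x hx'
  obtain ⟨z, rfl⟩ := hx'
  obtain ⟨U, hxU, rs, hlen, hreg, hI⟩ := h.2 z
  letI : Algebra Γ(X, U) (X.presheaf.stalk (i.base z)) := (X.presheaf.germ U (i.base z) hxU).hom.toAlgebra
  haveI := U.2.isLocalization_stalk ⟨i.base z, hxU⟩
  have mem : ∀ r ∈ rs, r ∈ (U.2.primeIdealOf ⟨i.base z, hxU⟩).asIdeal := by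
    intro r hr
    rw [← IsLocalization.AtPrime.to_map_mem_maximal_iff (X.presheaf.stalk (i.base z))
      (U.2.primeIdealOf ⟨i.base z, hxU⟩).asIdeal r]
    have hrI : r ∈ i.ker.ideal U := by
      rw [← hI]
      exact Ideal.subset_span hr
    exact germ_mem_maximalIdeal_of_mem_ker i U z hxU hrI
  have reg := hreg.isRegular_of_isLocalization_of_mem (X.presheaf.stalk (i.base z))
    (U.2.primeIdealOf ⟨i.base z, hxU⟩).asIdeal mem
  have hle := length_le_ringKrullDim_of_isRegular _ reg
  rw [List.length_map, hlen, AlgebraicGeometry.ringKrullDim_stalk_eq_coheight] at hle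
  exact_mod_cast hle

/-- pointwise form: the points of a regular immersion of codimension `n` have codimension `≥ n` (the clause of `HasBlochSeedAt`). -/
theorem coheight_ge_of_isRegularImmersionOfCodim {X Z : Scheme.{0}} {i : Z ⟶ X} {n : ℕ} (h : IsRegularImmersionOfCodim i n) :
    ∀ z ∈ Set.range i.base, (n : ℕ∞) ≤ Order.coheight z :=
  codimOfRegularImmersion i n h

end CodimLaw

/-! ## §14.1 One anchor suffices -/

section OneAnchor

variable {E₀ : AbelianVariety ℂ} {ψ₀ : E₀ ⟶ E₀} {C : ChernCharacterBetti}

/-- **THE ONE-ANCHOR DOOR**: the conclusion of `stub_rung_pad4_seedAt` on ONE CM anchor `(E₀, ψ₀)` (`E₀.dim = 1`, `ψ₀ ≫ ψ₀ = -1`)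
already gives the crux `BlochSeedDiscOne = HasHyperbolicBlochSeed 4 1` BY NAME — the crux quantifies the eightfold EXISTENTIALLY
(`P := pad4Anchor E₀`, `ψ := pad4Action E₀ ψ₀`, `dim = 2·4` by `pad4Anchor_dim`, `ψ² = -1` by `pad4Action_comp_self`). Hypothesis-carrying. -/
theorem blochSeedDiscOne_of_seedData_one (hE : E₀.dim = 1) (hψ : ψ₀ ≫ ψ₀ = -(1 • 𝟙 E₀))
    (h : ∃ (e : ProjectiveEmbedding (pad4Anchor E₀).X) (a : complexBetti (projectiveSpace e.n ℂ) 2)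
        (w : complexBetti (pad4Anchor E₀).X (2 * 4)),
        IsRationalClass a ∧ a ≠ 0 ∧
        IsHyperbolicWeilType (pad4Anchor E₀) (pad4Action E₀ ψ₀) 4 (symH (pad4Action E₀ ψ₀) e a) ∧
        w ∈ weilClassesOf (pad4Anchor E₀) (pad4Action E₀ ψ₀) 4 1 ∧ IsRationalClass w ∧ w ≠ 0 ∧
        HasBlochSeedAt 4 (pad4Anchor E₀) (symH (pad4Action E₀ ψ₀) e a) w) :
    Summit.HodgeConjecture.HodgeConjecture.Theses.EightfoldBlochSeeds.BlochSeedDiscOne := by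
  obtain ⟨e, a, w, ha, ha0, hhyp, hwW, hwr, hw0, hseed⟩ := h
  exact ⟨pad4Anchor E₀, pad4Action E₀ ψ₀, e, a, w, pad4Anchor_dim hE, pad4Action_comp_self hψ, ha, ha0, hhyp,
    hwW, hwr, hw0, hseed⟩

/-- **A SEED CERTIFICATE ON ONE CM ANCHOR ⟹ THE CRUX `BlochSeedDiscOne` BY NAME.** -/
theorem blochSeedDiscOne_of_certificate_one (hE : E₀.dim = 1) (hψ : ψ₀ ≫ ψ₀ = -(1 • 𝟙 E₀)) (c : SeedCertificate E₀ ψ₀) :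
    Summit.HodgeConjecture.HodgeConjecture.Theses.EightfoldBlochSeeds.BlochSeedDiscOne :=
  blochSeedDiscOne_of_seedData_one hE hψ (seedData_of_certificate hE hψ c)

/-- **A PASSING (design, presentation) PAIR ON ONE CM ANCHOR ⟹ THE CRUX `BlochSeedDiscOne` BY NAME.** -/
theorem blochSeedDiscOne_of_seedCheck_one (hE : E₀.dim = 1) (hψ : ψ₀ ≫ ψ₀ = -(1 • 𝟙 E₀)) {D : Design} {K : AnchorKit E₀ ψ₀}
    {Z : Scheme.{0}} {i : Z ⟶ (pad4Anchor E₀).X.left} {q : ℚ} (h : D.SeedCheck K i q) :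
    Summit.HodgeConjecture.HodgeConjecture.Theses.EightfoldBlochSeeds.BlochSeedDiscOne :=
  blochSeedDiscOne_of_seedData_one hE hψ (seedData_of_seedCheck hE hψ h)

/-- **THE LCI DOOR FROM A ZERO SCHEME ON ONE CM ANCHOR, GIVEN THE LAW** (v4 `Design.seedCheck_of_zeroScheme`, then §14.1). -/
theorem blochSeedDiscOne_of_zeroScheme_one (hE : E₀.dim = 1) (hψ : ψ₀ ≫ ψ₀ = -(1 • 𝟙 E₀)) {D : Design} (hC0 : D.ClassData)
    (K : AnchorKit E₀ ψ₀) {I : Finset ℕ} {𝓕 : (pad4Anchor E₀).X.left.Modules} (hloc : TopChernFourLocalisation C)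
    (hrk : HasRank 𝓕 4) (hcl : CleanAtSeed C I K.F (hStd E₀ K.η) 𝓕 D.mu) (h1 : 1 ∈ I) (h2 : 2 ∈ I) (h3 : 3 ∈ I)
    (s : Modules.unitModule (pad4Anchor E₀).X.left ⟶ 𝓕) {Z : Scheme.{0}} {i : Z ⟶ (pad4Anchor E₀).X.left}
    (hZ : IsZeroSchemeOf s i) (hreg : IsRegularImmersionOfCodim i 4) (hint : AlgebraicGeometry.IsIntegral Z)
    (hsr : IsBlochSemiregular i (2 * 4) 4) :
    Summit.HodgeConjecture.HodgeConjecture.Theses.EightfoldBlochSeeds.BlochSeedDiscOne := by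
  obtain ⟨q, hq⟩ := D.seedCheck_of_zeroScheme hE hψ hC0 K hloc hrk hcl h1 h2 h3 s hZ hreg hint
    (codimOfRegularImmersion i 4 hreg) hsr
  exact blochSeedDiscOne_of_seedCheck_one hE hψ hq

/-- **v4's `∀`-door IS the one-anchor door specialised to the CM curve `E_i` of `exists_cmCurve_sqrt_neg 1`** (re-derivation of
`blochSeedDiscOne_of_certificates`; shows where the universal quantifier is spent). -/
theorem blochSeedDiscOne_of_certificates_via_one
    (h : ∀ (E₀ : AbelianVariety ℂ) (ψ₀ : E₀ ⟶ E₀), E₀.dim = 1 → ψ₀ ≫ ψ₀ = -(1 • 𝟙 E₀) →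
      Nonempty (SeedCertificate E₀ ψ₀)) :
    Summit.HodgeConjecture.HodgeConjecture.Theses.EightfoldBlochSeeds.BlochSeedDiscOne := by
  obtain ⟨E₀, ψ₀, hE, hψ⟩ :=
    Literature.NumberTheory.EllipticCurves.CMEndomorphism.exists_cmCurve_sqrt_neg 1 one_pos
  obtain ⟨c⟩ := h E₀ ψ₀ hE hψ
  exact blochSeedDiscOne_of_certificate_one hE hψ c

end OneAnchor

/-! ## §14.2 The monad road (lci door and sheaf door) -/

section MonadRoad

variable {E₀ : AbelianVariety ℂ} {ψ₀ : E₀ ⟶ E₀} {C : ChernCharacterBetti} {D : Design}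
  {𝓔 : (pad4Anchor E₀).X.left.Modules}

/-- **THE TWISTED MONAD ROUTE, END TO END (lci door), GIVEN THE LAW**: `D` passes C0; `𝓕 = ker b ∕ im a` is a MONAD presentation of the
twisted design `D(t)` through a word frame linked to the kit's `(h_std, W)`; `𝓕` has rank `4`; `s` is a section of `𝓕` whose zero scheme
`i : Z ↪ S⁴` passes C5, C6, C7 ⟹ `D.SeedCheck K i q` for some `q` (the kernel ∕ cokernel cases are v4's
`Design.seedCheck_of_twistedKernelPresentation ∕ …Cokernel…`). -/
theorem Design.seedCheck_of_twistedMonadPresentation (hE : E₀.dim = 1) (hψ : ψ₀ ≫ ψ₀ = -(1 • 𝟙 E₀)) {D : Design}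
    (hC0 : D.ClassData) (K : AnchorKit E₀ ψ₀) {Φ : WordFrame E₀} (hΦ : Φ.LinksTo K.F (hStd E₀ K.η)) (t : ℤ)
    {𝓕 : (pad4Anchor E₀).X.left.Modules} (π : MonadPresentation C Φ (D.tw t) 𝓕) (hloc : TopChernFourLocalisation C)
    (hrk : HasRank 𝓕 4) (s : Modules.unitModule (pad4Anchor E₀).X.left ⟶ 𝓕) {Z : Scheme.{0}}
    {i : Z ⟶ (pad4Anchor E₀).X.left} (hZ : IsZeroSchemeOf s i) (hreg : IsRegularImmersionOfCodim i 4)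
    (hint : AlgebraicGeometry.IsIntegral Z) (hsr : IsBlochSemiregular i (2 * 4) 4) : ∃ q : ℚ, D.SeedCheck K i q :=
  D.seedCheck_of_zeroScheme hE hψ hC0 K hloc hrk
    (cleanAtSeed_of_realisedBy_of_mu_eq le_eight_of_mem_koszulWindow (π.realisedBy hΦ (D.tw_clean t hC0.1)) (D.tw_mu t))
    one_two_three_mem_koszulWindow.1 one_two_three_mem_koszulWindow.2.1 one_two_three_mem_koszulWindow.2.2 s hZ hreg hint
    (codimOfRegularImmersion i 4 hreg) hsr

/-- **… on ONE CM anchor this closes the crux BY NAME** (monad road; kernel and cokernel roads next). -/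
theorem blochSeedDiscOne_of_twistedMonadPresentation_one (hE : E₀.dim = 1) (hψ : ψ₀ ≫ ψ₀ = -(1 • 𝟙 E₀)) {D : Design}
    (hC0 : D.ClassData) (K : AnchorKit E₀ ψ₀) {Φ : WordFrame E₀} (hΦ : Φ.LinksTo K.F (hStd E₀ K.η)) (t : ℤ)
    {𝓕 : (pad4Anchor E₀).X.left.Modules} (π : MonadPresentation C Φ (D.tw t) 𝓕) (hloc : TopChernFourLocalisation C)
    (hrk : HasRank 𝓕 4) (s : Modules.unitModule (pad4Anchor E₀).X.left ⟶ 𝓕) {Z : Scheme.{0}}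
    {i : Z ⟶ (pad4Anchor E₀).X.left} (hZ : IsZeroSchemeOf s i) (hreg : IsRegularImmersionOfCodim i 4)
    (hint : AlgebraicGeometry.IsIntegral Z) (hsr : IsBlochSemiregular i (2 * 4) 4) :
    Summit.HodgeConjecture.HodgeConjecture.Theses.EightfoldBlochSeeds.BlochSeedDiscOne := by
  obtain ⟨q, hq⟩ := D.seedCheck_of_twistedMonadPresentation hE hψ hC0 K hΦ t π hloc hrk s hZ hreg hint hsr
  exact blochSeedDiscOne_of_seedCheck_one hE hψ hq

theorem blochSeedDiscOne_of_twistedKernelPresentation_one (hE : E₀.dim = 1) (hψ : ψ₀ ≫ ψ₀ = -(1 • 𝟙 E₀)) {D : Design}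
    (hC0 : D.ClassData) (K : AnchorKit E₀ ψ₀) {Φ : WordFrame E₀} (hΦ : Φ.LinksTo K.F (hStd E₀ K.η)) (t : ℤ)
    {𝓕 : (pad4Anchor E₀).X.left.Modules} (π : KernelPresentation C Φ (D.tw t) 𝓕) (hloc : TopChernFourLocalisation C)
    (hrk : HasRank 𝓕 4) (s : Modules.unitModule (pad4Anchor E₀).X.left ⟶ 𝓕) {Z : Scheme.{0}}
    {i : Z ⟶ (pad4Anchor E₀).X.left} (hZ : IsZeroSchemeOf s i) (hreg : IsRegularImmersionOfCodim i 4)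
    (hint : AlgebraicGeometry.IsIntegral Z) (hsr : IsBlochSemiregular i (2 * 4) 4) :
    Summit.HodgeConjecture.HodgeConjecture.Theses.EightfoldBlochSeeds.BlochSeedDiscOne := by
  obtain ⟨q, hq⟩ := D.seedCheck_of_twistedKernelPresentation hE hψ hC0 K hΦ t π hloc hrk s hZ hreg hint
    (codimOfRegularImmersion i 4 hreg) hsr
  exact blochSeedDiscOne_of_seedCheck_one hE hψ hq

theorem blochSeedDiscOne_of_twistedCokernelPresentation_one (hE : E₀.dim = 1) (hψ : ψ₀ ≫ ψ₀ = -(1 • 𝟙 E₀)) {D : Design}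
    (hC0 : D.ClassData) (K : AnchorKit E₀ ψ₀) {Φ : WordFrame E₀} (hΦ : Φ.LinksTo K.F (hStd E₀ K.η)) (t : ℤ)
    {𝓕 : (pad4Anchor E₀).X.left.Modules} (π : CokernelPresentation C Φ (D.tw t) 𝓕) (hloc : TopChernFourLocalisation C)
    (hrk : HasRank 𝓕 4) (s : Modules.unitModule (pad4Anchor E₀).X.left ⟶ 𝓕) {Z : Scheme.{0}}
    {i : Z ⟶ (pad4Anchor E₀).X.left} (hZ : IsZeroSchemeOf s i) (hreg : IsRegularImmersionOfCodim i 4)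
    (hint : AlgebraicGeometry.IsIntegral Z) (hsr : IsBlochSemiregular i (2 * 4) 4) :
    Summit.HodgeConjecture.HodgeConjecture.Theses.EightfoldBlochSeeds.BlochSeedDiscOne := by
  obtain ⟨q, hq⟩ := D.seedCheck_of_twistedCokernelPresentation hE hψ hC0 K hΦ t π hloc hrk s hZ hreg hint
    (codimOfRegularImmersion i 4 hreg) hsr
  exact blochSeedDiscOne_of_seedCheck_one hE hψ hq

/-- sheaf door, COKERNEL presentation (the one-liner v3 announced as «the other two alike»). -/
theorem hasHyperbolicBFSheafSeedOn_of_cokernelPresentation (hE : E₀.dim = 1) (hψ : ψ₀ ≫ ψ₀ = -(1 • 𝟙 E₀))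
    (W : WordKit E₀ ψ₀) (π : CokernelPresentation C W.Φ D 𝓔) (hC0 : D.ClassDataRankFree) {I : Finset ℕ} (h4 : 4 ∈ I)
    (hI : ∀ p ∈ I, p ≤ 8) (h𝓔 : IsFiniteLocallyFree 𝓔) (hsr : IsISemiregular h𝓔 {q' | q' + 1 ∈ I}) :
    HasHyperbolicBFSheafSeedOn C 4 1 I :=
  hasHyperbolicBFSheafSeedOn_of_sheafSeedCheckRankFree hE hψ
    (D.sheafSeedCheckRankFree_of_cokernelPresentation W π hC0 h4 hI h𝓔 hsr)

/-- sheaf door, MONAD presentation. -/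
theorem hasHyperbolicBFSheafSeedOn_of_monadPresentation (hE : E₀.dim = 1) (hψ : ψ₀ ≫ ψ₀ = -(1 • 𝟙 E₀))
    (W : WordKit E₀ ψ₀) (π : MonadPresentation C W.Φ D 𝓔) (hC0 : D.ClassDataRankFree) {I : Finset ℕ} (h4 : 4 ∈ I)
    (hI : ∀ p ∈ I, p ≤ 8) (h𝓔 : IsFiniteLocallyFree 𝓔) (hsr : IsISemiregular h𝓔 {q' | q' + 1 ∈ I}) :
    HasHyperbolicBFSheafSeedOn C 4 1 I :=
  hasHyperbolicBFSheafSeedOn_of_sheafSeedCheckRankFree hE hψ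
    (D.sheafSeedCheckRankFree_of_monadPresentation W π hC0 h4 hI h𝓔 hsr)

end MonadRoad

/-! ## §14.3 The `h⁴`-coefficient of the seed class is a json number -/

section JsonChernFour

/-- **the `hᵖ`-coefficient of `ch_p` named by the design: `c_p(D) ∕ p!`** (the rational number in `Design.RealisedBy`'s clauses). -/
def Design.chCoeff (D : Design) (p : Fin 9) : ℚ := ((D.coeff p : ℤ) : ℚ) / (((p : ℕ).factorial : ℕ) : ℚ)

/-- **THE DESIGN'S FOURTH-CHERN-CLASS `h⁴`-COEFFICIENT** (Newton in `ℚ[h]`, Fulton Ex. 3.2.3, `a_p = c_p∕p!`):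
`a₁⁴∕24 − a₁²a₂∕2 + a₂²∕2 + 2a₁a₃ − 6a₄`. A json-computable rational number. [cite: Fulton1998, Example 3.2.3] -/
def Design.chernFourCoeff (D : Design) : ℚ :=
  D.chCoeff 1 ^ 4 / 24 - D.chCoeff 1 ^ 2 * D.chCoeff 2 / 2 + D.chCoeff 2 ^ 2 / 2 + 2 * (D.chCoeff 1 * D.chCoeff 3) -
    6 * D.chCoeff 4

theorem Design.chCoeff_four (D : Design) : D.chCoeff 4 = ((D.coeff 4 : ℤ) : ℚ) / 24 := by
  simp only [Design.chCoeff]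
  norm_num [Nat.factorial]

/-- **THE DEGREE SIGN SCREEN at twist `t`** (json, `Bool`): `0 < chernFourCoeff (D(t))`. PENCIL reading (not a theorem here: no degree
functional in v4): with `h` ample, `deg_h Z(s) = chernFourCoeff(D(t)) · deg h⁸` for the zero scheme of a section of a rank-`4` realisation of
`D(t)`, so a NON-EMPTY seed of pure codimension `4` needs `true`. -/
def Design.degreeSignAt (D : Design) (t : ℤ) : Bool := decide (0 < (D.tw t).chernFourCoeff)

theorem Design.degreeSignAt_iff (D : Design) (t : ℤ) : D.degreeSignAt t = true ↔ 0 < (D.tw t).chernFourCoeff := by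
  simp [Design.degreeSignAt]

variable {E₀ : AbelianVariety ℂ} {ψ₀ : E₀ ⟶ E₀} {C : ChernCharacterBetti}

/-- **`c₄` OF A REALISATION IS PREDICTED BY THE JSON: `c₄(𝓕) = chernFourCoeff(D) · h⁴ + wOf(−6 μ(D))`** for any sheaf `𝓕` realising `D`
through the frame `(h, r₁, r₂)` (`Design.RealisedBy`; v4's `chernFour_eq_of_cleanAtSeed` with its `∃ q'` made explicit). -/
theorem Design.chernFour_eq_of_realisedBy {D : Design} {F : WeilFrame E₀ ψ₀} {h : complexBetti (pad4Anchor E₀).X 2}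
    {𝓕 : (pad4Anchor E₀).X.left.Modules} (hR : D.RealisedBy C F h 𝓕) :
    chernFour C (pad4Anchor E₀).X 𝓕 = ((D.chernFourCoeff : ℚ) : ℂ) • cupPowTwo h 4 + F.wOf ((-6 : ℤ) * D.mu) := by
  obtain ⟨-, hp, h4⟩ := hR
  have h1 : C.ch (pad4Anchor E₀).X 𝓕 1 = ((D.chCoeff 1 : ℚ) : ℂ) • cupPowTwo h 1 := hp 1 (by decide)
  have h2 : C.ch (pad4Anchor E₀).X 𝓕 2 = ((D.chCoeff 2 : ℚ) : ℂ) • cupPowTwo h 2 := hp 2 (by decide)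
  have h3 : C.ch (pad4Anchor E₀).X 𝓕 3 = ((D.chCoeff 3 : ℚ) : ℂ) • cupPowTwo h 3 := hp 3 (by decide)
  have h4' : C.ch (pad4Anchor E₀).X 𝓕 4 = ((D.chCoeff 4 : ℚ) : ℂ) • cupPowTwo h 4 + F.wOf D.mu := by
    rw [h4, D.chCoeff_four]
  rw [chernFour_eq_of_ch_eq h1 h2 h3 h4', WeilFrame.wOf_intCast_mul, sub_eq_add_neg, ← neg_smul]
  congr 1
  · congr 1
    simp only [Design.chernFourCoeff]
    push_cast
    ring
  · norm_num

/-- **(σ) OBJECT HALF WITH THE PREDICTED COEFFICIENT, GIVEN THE LAW**: for a rank-`4` bundle `𝓕` REALISING `D'` through `(h, F)` and the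
zero scheme `i : Z ↪ S⁴` of a section, **`(−chernFourCoeff(D')∕6) · h⁴ + wOf μ(D')` is supported on `Z`** (rescale `c₄` by `−1∕6`). -/
theorem supported_explicit_of_zeroScheme {D' : Design} {F : WeilFrame E₀ ψ₀} {h : complexBetti (pad4Anchor E₀).X 2}
    {𝓕 : (pad4Anchor E₀).X.left.Modules} (hloc : TopChernFourLocalisation C) (hrk : HasRank 𝓕 4)
    (hR : D'.RealisedBy C F h 𝓕) (s : Modules.unitModule (pad4Anchor E₀).X.left ⟶ 𝓕) {Z : Scheme.{0}}
    {i : Z ⟶ (pad4Anchor E₀).X.left} (hZ : IsZeroSchemeOf s i) :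
    (((-D'.chernFourCoeff / 6 : ℚ)) : ℂ) • cupPowTwo h 4 + F.wOf D'.mu ∈
      classesSupportedOn (pad4Anchor E₀).X (Set.range i.base) (2 * 4) := by
  have hmem := hloc (pad4Anchor E₀).X 𝓕 hrk s i hZ
  rw [D'.chernFour_eq_of_realisedBy hR, WeilFrame.wOf_intCast_mul] at hmem
  have hmem' := Submodule.smul_mem _ ((((-1 : ℚ) / 6 : ℚ)) : ℂ) hmem
  convert hmem' using 1
  rw [smul_add, smul_smul, smul_smul]
  congr 1
  · congr 1
    push_cast
    ring
  · push_cast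
    norm_num

/-- `(c • x)ⁱ = cⁱ • xⁱ` (private copy, as in every member of the family). [cite: HatcherAT2002, §3.2] -/
private theorem cupPowTwo_smul_aux₁₁ {Y : Type} [TopologicalSpace Y] (c : ℂ) (x : singularCohomology ℂ ℂ Y 2)
    (i : ℕ) : cupPowTwo (c • x) i = c ^ i • cupPowTwo x i := by
  induction i with
  | zero => rw [cupPowTwo_zero, cupPowTwo_zero, pow_zero, one_smul]
  | succ i ih =>
    rw [cupPowTwo_succ, cupPowTwo_succ, ih]
    simp only [map_smul, LinearMap.smul_apply, smul_smul, pow_succ, mul_comm]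

/-- **THE LCI DOOR WITH THE PREDICTED `q`, GIVEN THE LAW**: `D` passes C0; a rank-`4` bundle `𝓕` REALISES a design `D'` with `μ(D') = μ(D)`
(e.g. `D' = D(t)`) through the kit's `(h_std, W)`; `s` is a section with zero scheme `i : Z ↪ S⁴` passing C5, C6, C7 ⟹
**`D.SeedCheck K i q` with `q = −chernFourCoeff(D') ∕ (6 · (2 t_pol)⁴)`** (`h_K = 2t_pol · h_std`, v4 `AnchorKit.symH_eq`). -/
theorem Design.seedCheck_of_zeroScheme_explicit (hE : E₀.dim = 1) (hψ : ψ₀ ≫ ψ₀ = -(1 • 𝟙 E₀)) {D : Design}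
    (hC0 : D.ClassData) (K : AnchorKit E₀ ψ₀) {D' : Design} {𝓕 : (pad4Anchor E₀).X.left.Modules}
    (hloc : TopChernFourLocalisation C) (hrk : HasRank 𝓕 4) (hR : D'.RealisedBy C K.F (hStd E₀ K.η) 𝓕) (hmu : D'.mu = D.mu)
    (s : Modules.unitModule (pad4Anchor E₀).X.left ⟶ 𝓕) {Z : Scheme.{0}} {i : Z ⟶ (pad4Anchor E₀).X.left}
    (hZ : IsZeroSchemeOf s i) (hreg : IsRegularImmersionOfCodim i 4) (hint : AlgebraicGeometry.IsIntegral Z)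
    (hsr : IsBlochSemiregular i (2 * 4) 4) : D.SeedCheck K i (-D'.chernFourCoeff / 6 / (2 * K.pol.t) ^ 4) := by
  have hsupp := supported_explicit_of_zeroScheme hloc hrk hR s hZ
  rw [hmu] at hsupp
  refine ⟨hC0, hZ.isClosedImmersion, hreg, hint, codimOfRegularImmersion i 4 hreg, hsr, ?_⟩
  have ht : ((2 * K.pol.t : ℚ) : ℂ) ≠ 0 := by exact_mod_cast mul_ne_zero two_ne_zero K.pol.t_pos.ne'
  rw [K.symH_eq hE hψ, cupPowTwo_smul_aux₁₁, smul_smul]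
  convert hsupp using 3
  rw [← Rat.cast_pow, ← Rat.cast_mul, div_mul_cancel₀ _ (pow_ne_zero 4 (mul_ne_zero two_ne_zero K.pol.t_pos.ne'))]


/-! ### §14.3b The twist law for `c₄`: `chernFourCoeff (D(t))` is an explicit quartic in `t` -/

/-- `c₁`'s `h`-coefficient `a₁`. -/
def Design.chernOneCoeff (D : Design) : ℚ := D.chCoeff 1

/-- `c₂`'s `h²`-coefficient `a₁²∕2 − a₂` (Newton). [cite: Fulton1998, Example 3.2.3] -/
def Design.chernTwoCoeff (D : Design) : ℚ := D.chCoeff 1 ^ 2 / 2 - D.chCoeff 2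

/-- `c₃`'s `h³`-coefficient `a₁³∕6 − a₁a₂ + 2a₃` (Newton). [cite: Fulton1998, Example 3.2.3] -/
def Design.chernThreeCoeff (D : Design) : ℚ := D.chCoeff 1 ^ 3 / 6 - D.chCoeff 1 * D.chCoeff 2 + 2 * D.chCoeff 3

/-- the rank `c₀(D)` as a rational number (`Design.rank_eq_coeff`). -/
def Design.rankQ (D : Design) : ℚ := ((D.coeff 0 : ℤ) : ℚ)

theorem Design.chCoeff_zero (D : Design) : D.chCoeff 0 = D.rankQ := by
  simp [Design.chCoeff, Design.rankQ, Nat.factorial]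

theorem Design.chCoeff_one (D : Design) : D.chCoeff 1 = ((D.coeff 1 : ℤ) : ℚ) := by
  simp [Design.chCoeff, Nat.factorial]

theorem Design.chCoeff_two (D : Design) : D.chCoeff 2 = ((D.coeff 2 : ℤ) : ℚ) / 2 := by
  simp only [Design.chCoeff]
  norm_num [Nat.factorial]

theorem Design.chCoeff_three (D : Design) : D.chCoeff 3 = ((D.coeff 3 : ℤ) : ℚ) / 6 := by
  simp only [Design.chCoeff]
  norm_num [Nat.factorial]

/-- the twist law in degrees `1, …, 4`, closed form (`(D.tw t).coeff p = Σ_d C(p,d) t^{p−d} coeff d`, v4 `Design.tw_coeff`). -/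
theorem Design.tw_coeff_one (t : ℤ) (D : Design) (hD : D.Clean) :
    (D.tw t).coeff 1 = D.coeff 1 + t * D.coeff 0 := by
  rw [D.tw_coeff t hD 1]
  simp [Fin.sum_univ_succ, Nat.choose]
  ring

theorem Design.tw_coeff_two (t : ℤ) (D : Design) (hD : D.Clean) :
    (D.tw t).coeff 2 = D.coeff 2 + 2 * t * D.coeff 1 + t ^ 2 * D.coeff 0 := by
  rw [D.tw_coeff t hD 2]
  simp [Fin.sum_univ_succ, Nat.choose]
  ring

theorem Design.tw_coeff_three (t : ℤ) (D : Design) (hD : D.Clean) :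
    (D.tw t).coeff 3 = D.coeff 3 + 3 * t * D.coeff 2 + 3 * t ^ 2 * D.coeff 1 + t ^ 3 * D.coeff 0 := by
  rw [D.tw_coeff t hD 3]
  simp [Fin.sum_univ_succ, Nat.choose]
  ring

theorem Design.tw_coeff_four (t : ℤ) (D : Design) (hD : D.Clean) :
    (D.tw t).coeff 4 = D.coeff 4 + 4 * t * D.coeff 3 + 6 * t ^ 2 * D.coeff 2 + 4 * t ^ 3 * D.coeff 1 + t ^ 4 * D.coeff 0 := by
  rw [D.tw_coeff t hD 4]
  simp [Fin.sum_univ_succ, Nat.choose]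
  ring

theorem Design.tw_coeff_zero (t : ℤ) (D : Design) (hD : D.Clean) : (D.tw t).coeff 0 = D.coeff 0 := by
  rw [D.tw_coeff t hD 0]
  simp [Fin.sum_univ_succ, Nat.choose]

/-- **THE TWIST LAW FOR `c₄` (clean design of rank `r = c₀`): `c₄(D(t)) = c₄ + (r−3)c₃·t + C(r−2,2)c₂·t² + C(r−1,3)c₁·t³ + C(r,4)·t⁴`**
— the `h⁴`-coefficient of `c(E ⊗ L) = Σ_k c_k(E)(1 + t h)^{r−k}` (`c₁(L) = t·h`), here DERIVED from `ch(𝓔(tH)) = ch(𝓔)·e^{tH}`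
(`Design.tw_coeff`) and Newton by `ring`. [cite: Fulton1998, Example 3.2.2 and Example 3.2.3] -/
theorem Design.chernFourCoeff_tw (t : ℤ) (D : Design) (hD : D.Clean) :
    (D.tw t).chernFourCoeff =
      D.chernFourCoeff + (D.rankQ - 3) * D.chernThreeCoeff * t +
        (D.rankQ - 2) * (D.rankQ - 3) / 2 * D.chernTwoCoeff * t ^ 2 +
        (D.rankQ - 1) * (D.rankQ - 2) * (D.rankQ - 3) / 6 * D.chernOneCoeff * t ^ 3 +
        D.rankQ * (D.rankQ - 1) * (D.rankQ - 2) * (D.rankQ - 3) / 24 * t ^ 4 := by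
  simp only [Design.chernFourCoeff, Design.chernThreeCoeff, Design.chernTwoCoeff, Design.chernOneCoeff, Design.rankQ,
    Design.chCoeff_one, Design.chCoeff_two, Design.chCoeff_three, Design.chCoeff_four, D.tw_coeff_one t hD,
    D.tw_coeff_two t hD, D.tw_coeff_three t hD, D.tw_coeff_four t hD]
  push_cast
  ring

theorem Design.coeff_zero_eq_of_rank_eq (D : Design) {r : ℤ} (hr : D.rank = (r : GaussianInt)) : D.coeff 0 = r := by
  have h := D.rank_eq_coeff
  rw [hr] at h
  have h' := congrArg Zsqrtd.re h
  simpa only [Zsqrtd.re_intCast] using h'.symm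

/-- **FLAG (degeneracy door, virtual rank `3`): the `c₄`-coefficient — hence the degree sign screen — is TWIST-BLIND**: for a clean
design of rank `3` (the `K⁰`-class `[𝓝] − [𝓟]` of a two-term datum of ranks `(a, a+3)`, v5), `c₄(D(t)) = c₄(D)` for every `t` — one
json bit per design, not per twist (the degeneracy locus of `φ ⊗ L` is that of `φ`). -/
theorem Design.chernFourCoeff_tw_of_rank_three (t : ℤ) (D : Design) (hD : D.Clean) (h3 : D.rank = 3) :
    (D.tw t).chernFourCoeff = D.chernFourCoeff := by
  have h0 : D.rankQ = 3 := by
    simp only [Design.rankQ, D.coeff_zero_eq_of_rank_eq (r := 3) (by simpa using h3), Int.cast_ofNat]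
  rw [D.chernFourCoeff_tw t hD, h0]
  ring

/-- **FLAG (zero-scheme door, rank `4`): `c₄(D(t)) = c₄ + c₃t + c₂t² + c₁t³ + t⁴`** — a MONIC quartic in `t`, so the degree sign screen
passes for all `t ≫ 0` (below) and constrains only the presenter's ACTUAL twist. -/
theorem Design.chernFourCoeff_tw_of_rank_four (t : ℤ) (D : Design) (hD : D.Clean) (h4 : D.rank = 4) :
    (D.tw t).chernFourCoeff =
      D.chernFourCoeff + D.chernThreeCoeff * t + D.chernTwoCoeff * t ^ 2 + D.chernOneCoeff * t ^ 3 + t ^ 4 := by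
  have h0 : D.rankQ = 4 := by
    simp only [Design.rankQ, D.coeff_zero_eq_of_rank_eq (r := 4) (by simpa using h4), Int.cast_ofNat]
  rw [D.chernFourCoeff_tw t hD, h0]
  ring

/-- a monic rational quartic is positive beyond `1 + Σ|coefficients|`. -/
theorem quartic_pos_of_le {c₀ c₁ c₂ c₃ x : ℚ} (hx : 1 + (|c₀| + |c₁| + |c₂| + |c₃|) ≤ x) :
    0 < c₀ + c₁ * x + c₂ * x ^ 2 + c₃ * x ^ 3 + x ^ 4 := by
  have h1 : 1 ≤ x := le_trans (le_add_of_nonneg_right (by positivity)) hx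
  have hx0 : 0 ≤ x := le_trans zero_le_one h1
  have hS : |c₀| + |c₁| + |c₂| + |c₃| ≤ x - 1 := by linarith
  have hx2 : x ≤ x ^ 2 := by nlinarith
  have hx3 : x ^ 2 ≤ x ^ 3 := by nlinarith
  have e0 : -(|c₀| * x ^ 3) ≤ c₀ := by
    have : |c₀| ≤ |c₀| * x ^ 3 := le_mul_of_one_le_right (abs_nonneg _) (by nlinarith)
    linarith [neg_abs_le c₀]
  have e1 : -(|c₁| * x ^ 3) ≤ c₁ * x := by
    have : |c₁| * x ≤ |c₁| * x ^ 3 := mul_le_mul_of_nonneg_left (by nlinarith) (abs_nonneg _)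
    nlinarith [neg_abs_le c₁, abs_nonneg c₁]
  have e2 : -(|c₂| * x ^ 3) ≤ c₂ * x ^ 2 := by
    have : |c₂| * x ^ 2 ≤ |c₂| * x ^ 3 := mul_le_mul_of_nonneg_left hx3 (abs_nonneg _)
    nlinarith [neg_abs_le c₂, abs_nonneg c₂, sq_nonneg x]
  have e3 : -(|c₃| * x ^ 3) ≤ c₃ * x ^ 3 := by
    nlinarith [neg_abs_le c₃, abs_nonneg c₃, pow_nonneg hx0 3]
  have hx3pos : 0 < x ^ 3 := by positivity
  have key : x ^ 4 - (|c₀| + |c₁| + |c₂| + |c₃|) * x ^ 3 ≥ x ^ 3 := by nlinarith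
  nlinarith

/-- **FLAG (rank `4`): THE DEGREE SIGN SCREEN PASSES FOR EVERY `t ≥ 1 + |c₄| + |c₃| + |c₂| + |c₁|`** — asymptotically vacuous; it bites
only at the twist the presentation actually uses (HALL ∕ generation constraints keep `t` small). -/
theorem Design.degreeSignAt_of_rank_four (D : Design) (hD : D.Clean) (h4 : D.rank = 4) {t : ℤ}
    (ht : 1 + (|D.chernFourCoeff| + |D.chernThreeCoeff| + |D.chernTwoCoeff| + |D.chernOneCoeff|) ≤ (t : ℚ)) :
    D.degreeSignAt t = true := by
  rw [Design.degreeSignAt_iff, D.chernFourCoeff_tw_of_rank_four t hD h4]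
  exact quartic_pos_of_le ht

/-! ### §14.3d The json evaluator and the six designs of record -/

/-- `chernFourCoeff` as a function of the four integers `c₁, …, c₄` of the json (`c_p ↦ a_p = c_p∕p!`, then Newton). -/
def c4OfCoeffs (q₁ q₂ q₃ q₄ : ℤ) : ℚ :=
  (q₁ : ℚ) ^ 4 / 24 - (q₁ : ℚ) ^ 2 * ((q₂ : ℚ) / 2) / 2 + ((q₂ : ℚ) / 2) ^ 2 / 2 + 2 * ((q₁ : ℚ) * ((q₃ : ℚ) / 6)) -
    6 * ((q₄ : ℚ) / 24)

theorem Design.chernFourCoeff_eq_c4OfCoeffs (D : Design) :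
    D.chernFourCoeff = c4OfCoeffs (D.coeff 1) (D.coeff 2) (D.coeff 3) (D.coeff 4) := by
  simp only [Design.chernFourCoeff, Design.chCoeff_one, Design.chCoeff_two, Design.chCoeff_three, Design.chCoeff_four, c4OfCoeffs]

/-- **THE SIX DESIGNS OF RECORD ALL HAVE `c₄ > 0`** (their e-free coefficients `q_1, …, q_4` are the kernel-certified tables `q` of
`DesignCertS84Monad` (ac808a66, S′), `DesignCertS84A0` (08162ddb), `DesignCertS131Monad` (bf2edc09), `DesignCertS131LP` (027d680d),
`DesignCertS131Padded` (949081b9), `DesignCertM72` (1840bf64), hsemireg-check-kernel-1; `q_0 = 4` each): the untwisted degree sign screen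
passes for all six. (That `c₄(D(t)) > 0` for EVERY `t` — the rank-`4` quartic of §14.3b has a positive minimum `≈ 0.40·c₄(D)` for each — is
plain rational arithmetic recorded in the g10 memo, not a Lean theorem.) -/
theorem c4OfCoeffs_records :
    c4OfCoeffs (-1648) (-46928) (-990976) (-18549440) = 340026217936 ∧
    c4OfCoeffs (-1720) (-48944) (-1033312) (-19339712) = 401767795600 ∧
    c4OfCoeffs (-409952) (-13119488) (-314875904) (-6717440000) = 1177400427424506904576 ∧
    c4OfCoeffs (-3260984) (-104352512) (-2504468480) (-53428748288) = 4712040345478752434202112 ∧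
    c4OfCoeffs (-1823540) (-58354304) (-1400511488) (-29877665792) = 460782165309074434649440 ∧
    c4OfCoeffs 327480 10925136 231973056 4037976576 = 478919349895072602528 := by
  norm_num [c4OfCoeffs]

end JsonChernFour

/-! ### §14.3c The lci seed checker is TWIST-BLIND on the json side (`D(t)(−t) = D`) -/

section TwistBlind

theorem MCell.twEmb_trans_neg (t : ℤ) :
    (MCell.twEmb t).trans (MCell.twEmb (-t)) = Function.Embedding.refl MCell :=
  Function.Embedding.ext fun Z => by simp [MCell.tw_neg_tw]

/-- **`D(t)(−t) = D`** (the twist is an honest `ℤ`-action on designs). -/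
theorem Design.tw_neg_tw (t : ℤ) (D : Design) : (D.tw t).tw (-t) = D := by
  obtain ⟨⟨lo, up⟩, mN, mP⟩ := D
  simp only [Design.tw, Finset.map_map, MCell.twEmb_trans_neg, Finset.map_refl, neg_neg, MCell.tw_neg_tw]

/-- **(A1) is twist-INVARIANT (both directions).** -/
theorem Design.tw_clean_iff (t : ℤ) (D : Design) : (D.tw t).Clean ↔ D.Clean :=
  ⟨fun h => by simpa only [Design.tw_neg_tw] using (D.tw t).tw_clean (-t) h, D.tw_clean t⟩

/-- **C0 is twist-INVARIANT (both directions).** -/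
theorem Design.tw_classData_iff (t : ℤ) (D : Design) : (D.tw t).ClassData ↔ D.ClassData :=
  ⟨fun h => by simpa only [Design.tw_neg_tw] using (D.tw t).tw_classData (-t) h, D.tw_classData t⟩

variable {E₀ : AbelianVariety ℂ} {ψ₀ : E₀ ⟶ E₀}

/-- **FLAG (C5 «regular section of a twist»): THE lci SEED CHECKER IS TWIST-BLIND ON THE JSON SIDE** — `Design.SeedCheck` reads only
`D.ClassData` and `μ(D)`, both invariant under `D ↦ D(t)`; the twist `t` is PURE PRESENTATION DATA (which bundle `𝓔(tH)` the section lives in) and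
enters the checker only through the explicit `q = −c₄(D(t))∕6∕(2t_K)⁴` of §14.3 and the degree sign quartic of §14.3b. -/
theorem Design.tw_seedCheck_iff (t : ℤ) (D : Design) (K : AnchorKit E₀ ψ₀) {Z : Scheme.{0}}
    (i : Z ⟶ (pad4Anchor E₀).X.left) (q : ℚ) : (D.tw t).SeedCheck K i q ↔ D.SeedCheck K i q := by
  simp only [Design.SeedCheck, Design.tw_classData_iff, Design.tw_mu]

/-- and so is the C0 ∕ sheaf-door json datum `ClassDataRankFree`. -/
theorem Design.tw_classDataRankFree_iff (t : ℤ) (D : Design) : (D.tw t).ClassDataRankFree ↔ D.ClassDataRankFree := by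
  simp only [Design.ClassDataRankFree, Design.tw_clean_iff, Design.tw_mu]

end TwistBlind

/-! ## §14.4 Every section vanishes somewhere (GIVEN the law) -/

section Vanishing

variable {E₀ : AbelianVariety ℂ} {ψ₀ : E₀ ⟶ E₀} {C : ChernCharacterBetti}

/-- **THE FRAME SEPARATES `h⁴` FROM `W`**: `s·h⁴ + wOf ν = 0 ⟹ ν = 0`. TRUE for `h = h_std`, `h_K` (`h⁴` is balanced ∕ e-free, `W` is pure
`eeee ⊕ ēēēē`: v8 `SeedCheckerBalanced.WeilFrame.mu_eq_of_eq`), but a HYPOTHESIS in this v4-only satellite. -/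
def WeilFrame.SeparatesH4 (F : WeilFrame E₀ ψ₀) (h : complexBetti (pad4Anchor E₀).X 2) : Prop :=
  ∀ (s : ℂ) (ν : GaussianInt), s • cupPowTwo h 4 + F.wOf ν = 0 → ν = 0

/-- **A CLASS WITH NON-ZERO `W`-COORDINATE IS NOT SUPPORTED ON AN EMPTY SEED** (the tree's `classesSupportedOn_empty`): if
`s·h⁴ + wOf μ`, `μ ≠ 0`, is supported on `range i` for `i : Z ↪ S⁴`, then `Z ≠ ∅`. Door-agnostic (zero scheme, degeneracy locus, any
carrier). -/
theorem nonempty_of_supported {F : WeilFrame E₀ ψ₀} {h : complexBetti (pad4Anchor E₀).X 2} (hsep : F.SeparatesH4 h)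
    {μ : GaussianInt} (hμ : μ ≠ 0) {s : ℂ} {Z : Scheme.{0}} {i : Z ⟶ (pad4Anchor E₀).X.left}
    (hsupp : s • cupPowTwo h 4 + F.wOf μ ∈ classesSupportedOn (pad4Anchor E₀).X (Set.range i.base) (2 * 4)) :
    Nonempty Z := by
  by_contra hZ
  have hr : Set.range i.base = ∅ := Set.subset_empty_iff.1 (by
    rintro _ ⟨z, -⟩
    exact (hZ ⟨z⟩).elim)
  rw [hr, classesSupportedOn_empty] at hsupp
  exact hμ (hsep s μ ((Submodule.mem_bot ℂ).1 hsupp))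

/-- the (σ) class check on a separating frame forbids an empty seed. -/
theorem ClassCheck.seed_nonempty {K : AnchorKit E₀ ψ₀} (hsep : K.F.SeparatesH4 (symH (pad4Action E₀ ψ₀) K.pol.e K.pol.a))
    {μ : GaussianInt} {Z : Scheme.{0}} {i : Z ⟶ (pad4Anchor E₀).X.left} {q : ℚ} (hc : ClassCheck K μ i q) : Nonempty Z :=
  nonempty_of_supported hsep hc.1 hc.2

/-- FLAG: for the checker, non-emptiness of the seed is ALREADY implied by C6 (`IsIntegral Z` carries `Nonempty Z`). -/
theorem SeedCertificate.seed_nonempty (c : SeedCertificate E₀ ψ₀) : Nonempty c.Z := by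
  haveI := c.integral
  exact IsIntegral.nonempty

/-- **A NOWHERE-VANISHING SECTION KILLS `c₄`, GIVEN THE LAW**: if the zero scheme of `s` is EMPTY then `c₄(𝓕) = 0`
(`TopChernFourLocalisation` read on `Z = ∅`, `classesSupportedOn_empty`). -/
theorem chernFour_eq_zero_of_isEmpty {X : Motives.SchemeOver ℂ} {𝓕 : X.left.Modules} (hloc : TopChernFourLocalisation C)
    (hrk : HasRank 𝓕 4) (s : Modules.unitModule X.left ⟶ 𝓕) {Z : Scheme.{0}} {i : Z ⟶ X.left} (hZ : IsZeroSchemeOf s i)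
    (hZe : IsEmpty Z) : chernFour C X 𝓕 = 0 := by
  have hmem := hloc X 𝓕 hrk s i hZ
  have hr : Set.range i.base = ∅ := Set.subset_empty_iff.1 (by
    rintro _ ⟨z, -⟩
    exact (hZe.false z).elim)
  rw [hr, classesSupportedOn_empty] at hmem
  exact (Submodule.mem_bot ℂ).1 hmem

/-- **EVERY SECTION OF A RANK-`4` REALISATION OF A DESIGN WITH `μ ≠ 0` VANISHES SOMEWHERE, GIVEN THE LAW** (on a separating frame):
the class shadow of «`c₄ ≠ 0` ⟹ `Z(s) ≠ ∅`» — the (σ) design half alone forbids a nowhere-zero section, BEFORE any candidate exists. -/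
theorem nonempty_zeroScheme_of_realisedBy {D : Design} {F : WeilFrame E₀ ψ₀} {h : complexBetti (pad4Anchor E₀).X 2}
    {𝓕 : (pad4Anchor E₀).X.left.Modules} (hloc : TopChernFourLocalisation C) (hrk : HasRank 𝓕 4)
    (hR : D.RealisedBy C F h 𝓕) (hμ : D.mu ≠ 0) (hsep : F.SeparatesH4 h)
    (s : Modules.unitModule (pad4Anchor E₀).X.left ⟶ 𝓕) {Z : Scheme.{0}} {i : Z ⟶ (pad4Anchor E₀).X.left}
    (hZ : IsZeroSchemeOf s i) : Nonempty Z := by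
  by_contra hZn
  have hZe : IsEmpty Z := not_nonempty_iff.1 hZn
  have h0 := chernFour_eq_zero_of_isEmpty hloc hrk s hZ hZe
  rw [D.chernFour_eq_of_realisedBy hR] at h0
  have hν := hsep _ _ h0
  have h6 : ((-6 : ℤ) : GaussianInt) ≠ 0 := by decide
  exact hμ ((mul_eq_zero.1 hν).resolve_left h6)

end Vanishing

/-! ## §14.5 Redundancies INSIDE the checker: what C5's regular immersion already implies (theorems, §14.0) -/

section Redundancy

variable {E₀ : AbelianVariety ℂ} {ψ₀ : E₀ ⟶ E₀}

/-- **FLAG: TWO clauses of `Design.SeedCheck` ∕ `HasBlochSeedAt` are IMPLIED BY C5** — the standalone `IsClosedImmersion i` (first conjunct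
of `IsRegularImmersionOfCodim i 4`, tree `IsRegularImmersionOfCodim.isClosedImmersion`) AND C6's «closed points of codimension `≥ 4`»
(`codimOfRegularImmersion`, §14.0). The lci checker in minimal form has FIVE clauses: C0 json, C5 (lci of codimension `4`), C6 (integral),
C7 (Bloch-semiregular), (σ). -/
theorem Design.seedCheck_iff_minimal (D : Design) (K : AnchorKit E₀ ψ₀) {Z : Scheme.{0}} (i : Z ⟶ (pad4Anchor E₀).X.left) (q : ℚ) :
    D.SeedCheck K i q ↔
      D.ClassData ∧ IsRegularImmersionOfCodim i 4 ∧ AlgebraicGeometry.IsIntegral Z ∧ IsBlochSemiregular i (2 * 4) 4 ∧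
        ((q : ℚ) : ℂ) • cupPowTwo (symH (pad4Action E₀ ψ₀) K.pol.e K.pol.a) 4 + K.F.wOf D.mu ∈
          classesSupportedOn (pad4Anchor E₀).X (Set.range i.base) (2 * 4) :=
  ⟨fun ⟨h0, _, hreg, hint, _, hsr, hσ⟩ => ⟨h0, hreg, hint, hsr, hσ⟩,
    fun ⟨h0, hreg, hint, hsr, hσ⟩ => ⟨h0, hreg.isClosedImmersion, hreg, hint, codimOfRegularImmersion i 4 hreg, hsr, hσ⟩⟩

/-- constructor form of the five-clause checker. -/
theorem Design.seedCheck_of_five {D : Design} {K : AnchorKit E₀ ψ₀} {Z : Scheme.{0}} {i : Z ⟶ (pad4Anchor E₀).X.left} {q : ℚ}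
    (h0 : D.ClassData) (hreg : IsRegularImmersionOfCodim i 4) (hint : AlgebraicGeometry.IsIntegral Z)
    (hsr : IsBlochSemiregular i (2 * 4) 4)
    (hσ : ((q : ℚ) : ℂ) • cupPowTwo (symH (pad4Action E₀ ψ₀) K.pol.e K.pol.a) 4 + K.F.wOf D.mu ∈
      classesSupportedOn (pad4Anchor E₀).X (Set.range i.base) (2 * 4)) : D.SeedCheck K i q :=
  (D.seedCheck_iff_minimal K i q).2 ⟨h0, hreg, hint, hsr, hσ⟩

/-- **the crux's own predicate in minimal form**: a Bloch seed of codimension `n` IS an lci closed subscheme of codimension `n` that is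
integral, Bloch-semiregular and supports `q·h^n + w` — FOUR clauses (the `IsClosedImmersion` and codimension-of-points clauses of
`HasBlochSeedAt` are consequences of the lci clause). -/
theorem hasBlochSeedAt_iff_four {n : ℕ} {P : AbelianVariety ℂ} {h : complexBetti P.X 2} {w : complexBetti P.X (2 * n)} :
    HasBlochSeedAt n P h w ↔
      ∃ (Z : Scheme.{0}) (i : Z ⟶ P.X.left) (q : ℚ), IsRegularImmersionOfCodim i n ∧ AlgebraicGeometry.IsIntegral Z ∧
        IsBlochSemiregular i (2 * n) n ∧ ((q : ℚ) : ℂ) • cupPowTwo h n + w ∈ classesSupportedOn P.X (Set.range i.base) (2 * n) :=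
  ⟨fun ⟨Z, i, q, _, hreg, hint, _, hsr, hσ⟩ => ⟨Z, i, q, hreg, hint, hsr, hσ⟩,
    fun ⟨Z, i, q, hreg, hint, hsr, hσ⟩ =>
      ⟨Z, i, q, hreg.isClosedImmersion, hreg, hint, codimOfRegularImmersion i n hreg, hsr, hσ⟩⟩

/-- constructor form: a Bloch seed needs only lci of codimension `n`, integral, Bloch-semiregular, supported class. -/
theorem hasBlochSeedAt_of_four {n : ℕ} {P : AbelianVariety ℂ} {h : complexBetti P.X 2} {w : complexBetti P.X (2 * n)}
    {Z : Scheme.{0}} (i : Z ⟶ P.X.left) (q : ℚ) (hreg : IsRegularImmersionOfCodim i n)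
    (hint : AlgebraicGeometry.IsIntegral Z) (hsr : IsBlochSemiregular i (2 * n) n)
    (hσ : ((q : ℚ) : ℂ) • cupPowTwo h n + w ∈ classesSupportedOn P.X (Set.range i.base) (2 * n)) : HasBlochSeedAt n P h w :=
  hasBlochSeedAt_iff_four.2 ⟨Z, i, q, hreg, hint, hsr, hσ⟩

end Redundancy

end Summit.HodgeConjecture.HodgeConjecture.Cruxes.BlochSeedDiscOne.SeedChecker

end
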